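import Literature.NumberTheory.EllipticCurves.PAdicLFunctionOrderParityProofs
import Literature.NumberTheory.EllipticCurves.KatoRankBound
import Literature.NumberTheory.EllipticCurves.BSDSelmer

/-!
# `ord_{s=1} L(E,s) ≤ ord_{T=0} L_p(E,T)` up to analytic rank three, and the first residual cell

Consequences of the parity transfer `ord_T L_p(E,T) ≡ ord_{s=1} L(E,s) (mod 2)`
(`even_order_padicLFunction_iff_even_analyticRank`, `PAdicLFunctionOrderParityProofs`) combined
with three named facts taken as hypotheses at the prime `p` (good ordinary, odd):

* Kato's bound `corank_{ℤ_p} Sel_{p^∞}(E/ℚ) ≤ ord_{T=0} L_p(E,T)`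
  (`kato_selmerCorank_le_order_padicLFunction`; Kato 2004, Thm. 18.4);
* the `p`-parity theorem `corank_{ℤ_p} Sel_{p^∞} ≡ ord_{s=1} L (mod 2)`
  (`selmerCorank_mod_two_eq`; Dokchitser–Dokchitser 2010, Thm. 1.4);
* a `p`-converse theorem in corank one, `corank_{ℤ_p} Sel_{p^∞} = 1 ⟹ ord_{s=1} L = 1`, as the bare
  implication for the curve at hand (Skinner 2020, Thm. A′; Burungale–Skinner–Tian–Wan 2024,
  Thm. 1.10, `burungaleSkinnerTianWan_analyticRank_eq_one_of_selmerCorank_eq_one`), resp. in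
  corank zero (`corank = 0 ⟹ ord_{s=1} L = 0`; Skinner–Urban 2014, Thm. 2 (b)).

Results:

* `three_le_order_padicLFunction_of_odd_analyticRank` — `r_an` odd, `r_an ≥ 3 ⟹ ord_T L_p ≥ 3`
  (if `ord_T L_p = 1` then `corank ≤ 1` is odd, hence `1`, hence `r_an = 1`);
* `analyticRank_le_order_padicLFunction_of_le_three` — `r_an ≤ 3 ⟹ r_an ≤ ord_T L_p`;
* `selmerCorank_eq_two_of_order_padicLFunction_eq_two` and
  `four_le_order_padicLFunction_or_residual` — for `r_an = 4` either `ord_T L_p ≥ 4` or one is in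
  the residual cell `ord_T L_p = 2 = corank_{ℤ_p} Sel_{p^∞}(E/ℚ) < 4 = r_an`, which no theorem in
  print excludes (it contradicts the `p`-adic Birch–Swinnerton-Dyer conjecture of
  Mazur–Tate–Teitelbaum, §II.10, and the finiteness of `Ш(E)[p^∞]` together with BSD).

References: K. Kato, Astérisque 295 (2004), Thm. 18.4; T. and V. Dokchitser, Ann. of Math. 172
(2010), Thm. 1.4; C. Skinner, Ann. of Math. 191 (2020), Thm. A′; C. Skinner, E. Urban, Invent.
Math. 195 (2014), Thm. 2; B. Mazur, J. Tate, J. Teitelbaum, Invent. Math. 84 (1986), §II.10.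
-/

noncomputable section

open scoped MatrixGroups

open PowerSeries CongruenceSubgroup
open Literature.NumberTheory.EllipticCurves.ModularForms

namespace Literature.NumberTheory.EllipticCurves

variable (W : WeierstrassCurve ℚ) [W.IsElliptic] [W.IsGloballyMinimal] [NeZero (W.conductorNorm ℤ)]
  {f : CuspForm (Gamma0 (W.conductorNorm ℤ)) 2} (p : ℕ) [Fact p.Prime]

/-- **`r_an` odd and `≥ 3 ⟹ ord_{T=0} L_p(E,T) ≥ 3`** at an odd good ordinary prime `p ∤ N_E`,
granting Kato's bound, `p`-parity and the corank-one `p`-converse at `p`: `ord_T L_p` is odd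
(parity transfer) and `≠ 1`, since `ord_T L_p = 1` forces `corank_{ℤ_p} Sel_{p^∞} ≤ 1` (Kato), odd
(`p`-parity), hence `= 1`, hence `r_an = 1` (`p`-converse).
[cite: Kato2004, Thm 18.4] [cite: DokchitserDokchitserAnnals2010, Thm. 1.4] [cite: Skinner2020, Thm. A′] -/
theorem three_le_order_padicLFunction_of_odd_analyticRank (hf : IsNewformOf W f)
    (hpN : ¬ p ∣ W.conductorNorm ℤ) (hord : IsOrdinaryAt W p) (hp : p ≠ 2)
    (hKato : kato_selmerCorank_le_order_padicLFunction W p (f := f))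
    (hpar : selmerCorank_mod_two_eq W p)
    (hconv : W.selmerCorank p = 1 → W.analyticRank = 1)
    (hodd : Odd W.analyticRank) (h3 : 3 ≤ W.analyticRank) :
    3 ≤ (padicLFunction f (unitRoot W p : ℚ_[p])).order := by
  have hL0 := padicLFunction_unitRoot_ne_zero hord hf
  have hoT : (padicLFunction f (unitRoot W p : ℚ_[p])).order ≠ ⊤ :=
    fun h' ↦ hL0 (order_eq_top.mp h')
  obtain ⟨m, hm⟩ := ENat.ne_top_iff_exists.mp hoT
  -- `m` is odd
  have hmodd : Odd m := by
    have hpar' := even_order_padicLFunction_iff_even_analyticRank W p hf hpN hord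
    rw [← hm, ENat.toNat_coe] at hpar'
    rcases Nat.even_or_odd m with he | ho
    · exact absurd (hpar'.mp he) (Nat.not_even_iff_odd.mpr hodd)
    · exact ho
  -- `m ≠ 1`
  have hm1 : m ≠ 1 := by
    intro hm1
    have hk := hKato hp hord hf
    rw [← hm, hm1, Nat.cast_one] at hk
    have hc1 : W.selmerCorank p ≤ 1 := by exact_mod_cast hk
    have hpm : W.selmerCorank p % 2 = W.analyticRank % 2 := hpar
    rw [Nat.odd_iff.mp hodd] at hpm
    have hc : W.selmerCorank p = 1 := by omega
    have h1 := hconv hc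
    omega
  rw [← hm]
  obtain ⟨k, rfl⟩ := hmodd
  exact_mod_cast (show 3 ≤ 2 * k + 1 by omega)

/-- **`r_an ≤ 3 ⟹ r_an ≤ ord_{T=0} L_p(E,T)`** at an odd good ordinary prime `p ∤ N_E`, granting
Kato's bound, `p`-parity and the corank-one `p`-converse at `p` (the cases `r_an ≤ 2` are
unconditional, `analyticRank_le_order_padicLFunction_of_le_two`).
[cite: Kato2004, Thm 18.4] [cite: DokchitserDokchitserAnnals2010, Thm. 1.4] [cite: Skinner2020, Thm. A′] -/
theorem analyticRank_le_order_padicLFunction_of_le_three (hf : IsNewformOf W f)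
    (hpN : ¬ p ∣ W.conductorNorm ℤ) (hord : IsOrdinaryAt W p) (hp : p ≠ 2)
    (hKato : kato_selmerCorank_le_order_padicLFunction W p (f := f))
    (hpar : selmerCorank_mod_two_eq W p)
    (hconv : W.selmerCorank p = 1 → W.analyticRank = 1) (h3 : W.analyticRank ≤ 3) :
    (W.analyticRank : ℕ∞) ≤ (padicLFunction f (unitRoot W p : ℚ_[p])).order := by
  rcases Nat.lt_or_ge W.analyticRank 3 with h | h
  · exact analyticRank_le_order_padicLFunction_of_le_two W p hf hpN hord (by omega)
  · have ha : W.analyticRank = 3 := le_antisymm h3 h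
    rw [ha, Nat.cast_ofNat]
    exact three_le_order_padicLFunction_of_odd_analyticRank W p hf hpN hord hp hKato hpar hconv
      (by rw [ha]; exact ⟨1, rfl⟩) h

omit [W.IsElliptic] in
/-- **The residual cell at `ord_{T=0} L_p = 2`.** At an odd good ordinary prime `p ∤ N_E`, granting
Kato's bound, `p`-parity and the corank-zero `p`-converse at `p`: if `r_an` is even and positive
and `ord_{T=0} L_p(E,T) = 2`, then `corank_{ℤ_p} Sel_{p^∞}(E/ℚ) = 2` — whatever `r_an` is.
[cite: Kato2004, Thm 18.4] [cite: DokchitserDokchitserAnnals2010, Thm. 1.4] [cite: SkinnerUrban2014, Thm. 2] -/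
theorem selmerCorank_eq_two_of_order_padicLFunction_eq_two (hf : IsNewformOf W f)
    (hord : IsOrdinaryAt W p) (hp : p ≠ 2)
    (hKato : kato_selmerCorank_le_order_padicLFunction W p (f := f))
    (hpar : selmerCorank_mod_two_eq W p)
    (hconv0 : W.selmerCorank p = 0 → W.analyticRank = 0)
    (hev : Even W.analyticRank) (h0 : W.analyticRank ≠ 0)
    (hρ : (padicLFunction f (unitRoot W p : ℚ_[p])).order = 2) :
    W.selmerCorank p = 2 := by
  have hk := hKato hp hord hf
  rw [hρ] at hk
  have hc2 : W.selmerCorank p ≤ 2 := by exact_mod_cast hk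
  have hpm : W.selmerCorank p % 2 = W.analyticRank % 2 := hpar
  rw [Nat.even_iff.mp hev] at hpm
  have hc0 : W.selmerCorank p ≠ 0 := fun hc ↦ h0 (hconv0 hc)
  omega

/-- **Analytic rank four: transfer or residual cell.** At an odd good ordinary prime `p ∤ N_E`,
granting Kato's bound, `p`-parity and the corank-zero `p`-converse at `p`, a curve with
`ord_{s=1} L(E,s) = 4` has either `ord_{T=0} L_p(E,T) ≥ 4` or
`ord_{T=0} L_p(E,T) = 2 = corank_{ℤ_p} Sel_{p^∞}(E/ℚ)`; the second alternative is excluded by no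
theorem in print. [cite: Kato2004, Thm 18.4] [cite: DokchitserDokchitserAnnals2010, Thm. 1.4]
[cite: MazurTateTeitelbaum1986Invent, §II.10 (p-adic BSD)] -/
theorem four_le_order_padicLFunction_or_residual (hf : IsNewformOf W f)
    (hpN : ¬ p ∣ W.conductorNorm ℤ) (hord : IsOrdinaryAt W p) (hp : p ≠ 2)
    (hKato : kato_selmerCorank_le_order_padicLFunction W p (f := f))
    (hpar : selmerCorank_mod_two_eq W p)
    (hconv0 : W.selmerCorank p = 0 → W.analyticRank = 0) (h4 : W.analyticRank = 4) :
    4 ≤ (padicLFunction f (unitRoot W p : ℚ_[p])).order ∨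
      ((padicLFunction f (unitRoot W p : ℚ_[p])).order = 2 ∧ W.selmerCorank p = 2) := by
  have hev : Even W.analyticRank := by rw [h4]; exact ⟨2, rfl⟩
  have h0 : W.analyticRank ≠ 0 := by omega
  have hL0 := padicLFunction_unitRoot_ne_zero hord hf
  have hoT : (padicLFunction f (unitRoot W p : ℚ_[p])).order ≠ ⊤ :=
    fun h' ↦ hL0 (order_eq_top.mp h')
  obtain ⟨m, hm⟩ := ENat.ne_top_iff_exists.mp hoT
  have h2 := two_le_order_padicLFunction_of_even_analyticRank W p hf hpN hord h0 hev
  have hmev : Even m := by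
    have hpar' := (even_order_padicLFunction_iff_even_analyticRank W p hf hpN hord).mpr hev
    rwa [← hm, ENat.toNat_coe] at hpar'
  rw [← hm] at h2 ⊢
  have h2' : 2 ≤ m := by exact_mod_cast h2
  by_cases hm2 : m = 2
  · right
    refine ⟨by rw [hm2]; rfl, ?_⟩
    exact selmerCorank_eq_two_of_order_padicLFunction_eq_two W p hf hord hp hKato hpar hconv0 hev h0
      (by rw [← hm, hm2]; rfl)
  · left
    obtain ⟨k, rfl⟩ := hmev
    exact_mod_cast (show 4 ≤ k + k by omega)

end Literature.NumberTheory.EllipticCurves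

end
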